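import Literature.Analysis.FluidPDE.NSBoundedMildOseen
import Literature.Analysis.FluidPDE.OseenKernelSemigroup
import Literature.Analysis.UnboundedOperators.HeatKernelGaussianData
import HarnessLib

/-!
# Restart of the Oseen integral equation for bounded mild solutions (KNSS 2009, §4)

Analysis/FluidPDE proof file discharging the named fact
`Literature.Analysis.FluidPDE.oseenMild_restart` of `NSBoundedMildOseen.lean`
(Koch–Nadirashvili–Seregin–Šverák, *Liouville theorems for the Navier–Stokes equations and
applications*, Acta Math. 203 (2009) = arXiv:0709.3599, §4 p. 8: the integral equation
`u = U + B(u,u)`, `U = e^{νtΔ}u₀`, `B(u,v)ᵢ = -∫₀ᵗ∫ K_{ijk}(x-y,t-s) u_k v_j dy ds`, may be treated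
"as an ODE in `t`" on `L^∞_{x,t}`; Rem. 4.1). **Statement proved** (`oseenMild_restart_holds`):
if `u` is jointly measurable on `(0, T) × E` with measurable initial slice, slices uniformly
essentially bounded on every `[0, T₁)`, `T₁ < T` (datum included), and
`u(t) = e^{νtΔ}u(0) - B^ν_0(u,u)(t)` a.e. for every `t ∈ (0, T)`, then for all `0 < s < t < T`,
`u(t) = e^{ν(t-s)Δ}u(s) - B^ν_s(u,u)(t)` a.e. (The heat-flow part is proved for the wider class of
data integrable against Gaussians, `HeatKernelGaussianData.lean`, which bounded measurable data
belong to.)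

## The proof

With `D(s₀, s₁; t)(x) = ∫_{τ ∈ (s₀,s₁)} ∫ K(ν(t-τ), x-y)[u(τ,y), u(τ,y)] dy dτ` (so that
`B^ν_s(u,u)(t) = D(s, t; t)`), for `0 < s < t` and every `x`:

1. `e^{ν(t-s)Δ} u(s) = e^{ν(t-s)Δ}[e^{νsΔ}u(0) - B^ν_0(u,u)(s)]` (the convolution only sees the
   a.e. class of `u(s)`), `= e^{νtΔ}u(0) - e^{ν(t-s)Δ}B^ν_0(u,u)(s)` (semigroup law of the heat
   flow on Gaussian-integrable data, `HeatKernelGaussianData.lean`, and additivity at a point of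
   absolute convergence);
2. `e^{ν(t-s)Δ} B^ν_0(u,u)(s) = D(0, s; t)` — Fubini under Koch–Tataru's bound (14) and the
   **semigroup law of the Oseen kernel** `e^{aΔ}K(b) = K(a + b)` (`OseenKernelSemigroup.lean`);
3. `B^ν_0(u,u)(t) = D(0, s; t) + B^ν_s(u,u)(t)` (additivity of the time integral, the slice
   integrals being `O((t-τ)^{-1/2})`, integrable);

whence `e^{νtΔ}u(0) - B^ν_0(u,u)(t) = e^{ν(t-s)Δ}u(s) - B^ν_s(u,u)(t)` everywhere. The analysis
in 2–3 is carried out for a bounded, jointly (strongly) measurable representative `w` of `u` on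
the slab `(0, T₁) × E` (radial retraction of a strongly measurable version; the Duhamel terms
and the hypotheses only see slices up to null sets, for a.e. time).

Everything is proved; no new definitions or named facts.

## Mathlib / tree search

Tree: `oseenDuhamel`, `oseenMild_restart` (`NSBoundedMildOseen`); `heatExtension_oseenKernel`,
`integral_heatKernel_smul_oseenKernel_sub` (`OseenKernelSemigroup`);
`heatExtension_heatExtension_of_integrable_heatKernel_mul_norm`, `integrable_heatKernel_smul_sub`,
`integrable_heatKernel_mul_convolution_norm`, `heatExtension_congr_ae'`,
`heatExtension_sub_apply_of_integrable` (`HeatKernelGaussianData`); `exists_norm_oseenKernel_le`,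
`lintegral_add_norm_sq_rpow_neg`, `integrable_add_norm_sq_rpow_neg`,
`integral_one_add_norm_sq_rpow_neg_pos` (`KochTataruKernel`); `Measurable.oseenKernel_comp`,
`setLIntegral_Ioo_rpow_neg_half`, `lintegral_weight_sub_left` (`KochTataruPointwise`);
`volume_restrict_prod_univ_eq_prod` (`KatoUniquenessDual`); `continuous_radialRetract`,
`norm_radialRetract_le`, `radialRetract_eq_self` (`BoundedRepresentative`). Mathlib:
`integrable_prod_iff`, `integral_prod`, `integral_integral_swap`, `Integrable.integral_prod_left`,
`Measure.ae_ae_of_ae_prod`, `setIntegral_union`, `Ioo_union_Ico_eq_Ioo`, `Ioo_ae_eq_Ico`.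

## References

* G. Koch, N. Nadirashvili, G. Seregin, V. Šverák, Acta Math. 203 (2009) 83–105 =
  arXiv:0709.3599, §3 p. 6 (representation formula, kernel bounds) and §4 p. 8 (`B(u,v)`,
  `u = U + B(u,u)` as an ODE in `t`, Rem. 4.1). [KochNadirashviliSereginSverak2009]
* P. G. Lemarié-Rieusset, *The Navier–Stokes problem in the 21st century*, CRC Press 2016,
  Thm. 6.1 (6.12) and the proof of Thm. 9.12, (9.38). [LemarieRieusset2016]
* H. Koch, D. Tataru, Adv. Math. 157 (2001), §2 (8), §3 (11), (14). [KochTataruAdvMath2001]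
-/

noncomputable section

open MeasureTheory Set Function Filter Metric Real
open _root_.Topology
open scoped ENNReal NNReal RealInnerProductSpace

namespace Literature.Analysis.FluidPDE

open UnboundedOperators (heatKernel heatExtension)

variable {E : Type*} [NormedAddCommGroup E] [InnerProductSpace ℝ E] [FiniteDimensional ℝ E]
  [MeasurableSpace E] [BorelSpace E]

/-! ## Kernel slices against bounded fields -/

section Slices

/-- **`L¹` size of a kernel slice against bounded fields** (Koch–Tataru 2001, (14) integrated:
KNSS 2009, §3 p. 6, the bound `|K_{ijk}(x,t)| ≤ C(|x|² + t)^{-(n+1)/2}` behind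
`‖B(u,v)‖ ≤ C√T ‖u‖‖v‖`): there is `C = C(E) > 0` such that for `σ > 0`, fields `a, b` bounded
by `M ≥ 0` and every `x`, `∫ ‖K(σ, x - y)[a(y), b(y)]‖ dy ≤ C σ^{-1/2} M²` (in `ℝ≥0∞`). [cite: KochNadirashviliSereginSverak2009, §3 p. 6 and §4 p. 8 (arXiv:0709.3599)] -/
theorem exists_lintegral_enorm_oseenKernel_comp_sub_le_of_bound :
    ∃ C : ℝ, 0 < C ∧ ∀ {σ : ℝ}, 0 < σ → ∀ {M : ℝ}, 0 ≤ M → ∀ {a b : E → E},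
      (∀ y, ‖a y‖ ≤ M) → (∀ y, ‖b y‖ ≤ M) → ∀ x : E,
        ∫⁻ y, ‖oseenKernel σ (x - y) (a y) (b y)‖ₑ ≤
          ENNReal.ofReal (C * σ ^ (-(1 / 2 : ℝ)) * M ^ 2) := by
  set d : ℝ := (Module.finrank ℝ E : ℝ) with hd
  obtain ⟨C, hC, hK⟩ := exists_norm_oseenKernel_le (E := E)
  set Mw : ℝ := ∫ w : E, (1 + ‖w‖ ^ 2) ^ (-((d + 1) / 2)) with hMw
  have he : d < 2 * ((d + 1) / 2) := by linarith
  have hMw0 : 0 < Mw := integral_one_add_norm_sq_rpow_neg_pos he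
  refine ⟨C * Mw, by positivity, fun {σ} hσ {M} hM {a b} ha hb x => ?_⟩
  have hdom : ∀ y : E, ‖oseenKernel σ (x - y) (a y) (b y)‖ ≤
      C * M ^ 2 * (σ + ‖x - y‖ ^ 2) ^ (-((d + 1) / 2)) := by
    intro y
    calc ‖oseenKernel σ (x - y) (a y) (b y)‖
        ≤ C * (σ + ‖x - y‖ ^ 2) ^ (-((d + 1) / 2)) * ‖a y‖ * ‖b y‖ := hK hσ (x - y) (a y) (b y)
      _ ≤ C * (σ + ‖x - y‖ ^ 2) ^ (-((d + 1) / 2)) * M * M := by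
          have h0 : 0 ≤ C * (σ + ‖x - y‖ ^ 2) ^ (-((d + 1) / 2)) :=
            mul_nonneg hC.le (Real.rpow_nonneg (by positivity) _)
          exact mul_le_mul (mul_le_mul_of_nonneg_left (ha y) h0) (hb y) (norm_nonneg _)
            (mul_nonneg h0 hM)
      _ = C * M ^ 2 * (σ + ‖x - y‖ ^ 2) ^ (-((d + 1) / 2)) := by ring
  have hscal : d / 2 - (d + 1) / 2 = -(1 / 2 : ℝ) := by ring
  calc ∫⁻ y, ‖oseenKernel σ (x - y) (a y) (b y)‖ₑ
      ≤ ∫⁻ y, ENNReal.ofReal (C * M ^ 2) * ENNReal.ofReal ((σ + ‖x - y‖ ^ 2) ^ (-((d + 1) / 2))) := by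
        refine lintegral_mono fun y => ?_
        rw [← ENNReal.ofReal_mul (by positivity), ← ofReal_norm]
        exact ENNReal.ofReal_le_ofReal (hdom y)
    _ = ENNReal.ofReal (C * M ^ 2) * ENNReal.ofReal (σ ^ (-(1 / 2 : ℝ)) * Mw) := by
        rw [lintegral_const_mul' _ _ ENNReal.ofReal_ne_top, lintegral_weight_sub_left,
          lintegral_add_norm_sq_rpow_neg he hσ, hscal]
    _ = ENNReal.ofReal (C * Mw * σ ^ (-(1 / 2 : ℝ)) * M ^ 2) := by
        rw [← ENNReal.ofReal_mul (by positivity)]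
        congr 1; ring

/-- **Integrability of a kernel slice against bounded measurable fields**: for `σ > 0`, `a, b`
a.e.-measurable and bounded by `M`, `y ↦ K(σ, x - y)[a(y), b(y)]` is integrable (domination by
the integrable parabolic weight `C M² (σ + ‖x - y‖²)^{-(d+1)/2}`, Koch–Tataru's (14)). [cite: KochTataruAdvMath2001, §3 (14)] -/
theorem integrable_oseenKernel_comp_sub_of_bound {σ : ℝ} (hσ : 0 < σ) {M : ℝ} {a b : E → E}
    (ham : AEMeasurable a volume) (hbm : AEMeasurable b volume)
    (ha : ∀ y, ‖a y‖ ≤ M) (hb : ∀ y, ‖b y‖ ≤ M) (x : E) :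
    Integrable (fun y => oseenKernel σ (x - y) (a y) (b y)) volume := by
  set d : ℝ := (Module.finrank ℝ E : ℝ) with hd
  obtain ⟨C, hC, hK⟩ := exists_norm_oseenKernel_le (E := E)
  have he : d < 2 * ((d + 1) / 2) := by linarith
  have hM : 0 ≤ M := (norm_nonneg _).trans (ha x)
  have hw := (integrable_add_norm_sq_rpow_neg (E := E) he hσ).comp_sub_left x
  refine ((hw.const_mul (C * M ^ 2))).mono'
    (AEMeasurable.oseenKernel_comp aemeasurable_const (measurable_const.sub measurable_id).aemeasurable
      ham hbm).aestronglyMeasurable (Eventually.of_forall fun y => ?_)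
  calc ‖oseenKernel σ (x - y) (a y) (b y)‖
      ≤ C * (σ + ‖x - y‖ ^ 2) ^ (-((d + 1) / 2)) * ‖a y‖ * ‖b y‖ := hK hσ (x - y) (a y) (b y)
    _ ≤ C * (σ + ‖x - y‖ ^ 2) ^ (-((d + 1) / 2)) * M * M := by
        have h0 : 0 ≤ C * (σ + ‖x - y‖ ^ 2) ^ (-((d + 1) / 2)) :=
          mul_nonneg hC.le (Real.rpow_nonneg (by positivity) _)
        exact mul_le_mul (mul_le_mul_of_nonneg_left (ha y) h0) (hb y) (norm_nonneg _)
          (mul_nonneg h0 hM)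
    _ = C * M ^ 2 * (σ + ‖x - y‖ ^ 2) ^ (-((d + 1) / 2)) := by ring

end Slices

/-! ## The Duhamel integrand of a bounded measurable field on a time slab -/

section Slab

variable {ν : ℝ} {w : ℝ → E → E} {M : ℝ}

/-- **The Duhamel integrand of a bounded measurable field is integrable on every time slab**, with
a bound uniform in the base point: for `ν > 0`, `w` jointly measurable with `‖w‖ ≤ M`, and
`s₀ < s₁ ≤ t`, the integrand `(τ, y) ↦ K(ν(t-τ), z - y)[w(τ,y), w(τ,y)]` is integrable on
`(s₀, s₁) × E` and `∫∫ ‖K(ν(t-τ), z - y)[w, w]‖ dy dτ ≤ 2 C ν^{-1/2} M² (t - s₀)^{1/2}` for every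
`z` (KNSS 2009, §4 p. 8: "estimate (decay) easily implies `‖B(u,v)‖ ≤ C√T ‖u‖ ‖v‖`"). [cite: KochNadirashviliSereginSverak2009, §4 p. 8, the estimate for B (arXiv:0709.3599)] -/
theorem exists_integrable_oseenKernel_restart_slab (hν : 0 < ν) (hw : Measurable (uncurry w))
    (hM : ∀ τ y, ‖w τ y‖ ≤ M) {s₀ s₁ t : ℝ} (hs : s₀ < s₁) (hst : s₁ ≤ t) :
    ∃ B : ℝ, 0 ≤ B ∧ ∀ z : E,
      Integrable (fun p : ℝ × E => oseenKernel (ν * (t - p.1)) (z - p.2) (w p.1 p.2) (w p.1 p.2))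
          (((volume : Measure ℝ).restrict (Ioo s₀ s₁)).prod (volume : Measure E)) ∧
        ∫ p, ‖oseenKernel (ν * (t - p.1)) (z - p.2) (w p.1 p.2) (w p.1 p.2)‖
            ∂(((volume : Measure ℝ).restrict (Ioo s₀ s₁)).prod (volume : Measure E)) ≤ B := by
  obtain ⟨C, hC, hK⟩ := exists_lintegral_enorm_oseenKernel_comp_sub_le_of_bound (E := E)
  have hM0 : 0 ≤ M := (norm_nonneg _).trans (hM 0 0)
  set B : ℝ := C * ν ^ (-(1 / 2 : ℝ)) * M ^ 2 * (2 * Real.sqrt (t - s₀)) with hB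
  have hB0 : 0 ≤ B := by positivity
  refine ⟨B, hB0, fun z => ?_⟩
  set μ : Measure (ℝ × E) := ((volume : Measure ℝ).restrict (Ioo s₀ s₁)).prod volume with hμ
  set F : ℝ × E → E := fun p => oseenKernel (ν * (t - p.1)) (z - p.2) (w p.1 p.2) (w p.1 p.2)
    with hF
  -- measurability
  have hFm : Measurable F := by
    refine Measurable.oseenKernel_comp (measurable_const.mul (measurable_const.sub measurable_fst))
      (measurable_const.sub measurable_snd) hw hw
  -- the `∫⁻` bound by Tonelli
  have hlin : ∫⁻ p, ‖F p‖ₑ ∂μ ≤ ENNReal.ofReal B := by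
    rw [hμ, lintegral_prod _ hFm.enorm.aemeasurable]
    have hslice : ∀ τ ∈ Ioo s₀ s₁, ∫⁻ y, ‖F (τ, y)‖ₑ ≤
        ENNReal.ofReal (C * ν ^ (-(1 / 2 : ℝ)) * M ^ 2) * ENNReal.ofReal ((t - τ) ^ (-(1 / 2 : ℝ))) := by
      intro τ hτ
      have hτt : 0 < t - τ := by linarith [hτ.2]
      have hσ : 0 < ν * (t - τ) := mul_pos hν hτt
      have h := hK hσ hM0 (a := w τ) (b := w τ) (hM τ) (hM τ) z
      rw [← ENNReal.ofReal_mul (by positivity)]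
      refine h.trans (le_of_eq ?_)
      congr 1
      rw [Real.mul_rpow hν.le hτt.le]
      ring
    calc ∫⁻ τ in Ioo s₀ s₁, ∫⁻ y, ‖F (τ, y)‖ₑ
        ≤ ∫⁻ τ in Ioo s₀ s₁, ENNReal.ofReal (C * ν ^ (-(1 / 2 : ℝ)) * M ^ 2) *
            ENNReal.ofReal ((t - τ) ^ (-(1 / 2 : ℝ))) :=
          setLIntegral_mono' measurableSet_Ioo fun τ hτ => hslice τ hτ
      _ = ENNReal.ofReal (C * ν ^ (-(1 / 2 : ℝ)) * M ^ 2) *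
            ∫⁻ τ in Ioo s₀ s₁, ENNReal.ofReal ((t - τ) ^ (-(1 / 2 : ℝ))) :=
          lintegral_const_mul' _ _ ENNReal.ofReal_ne_top
      _ ≤ ENNReal.ofReal (C * ν ^ (-(1 / 2 : ℝ)) * M ^ 2) *
            ∫⁻ τ in Ioo s₀ t, ENNReal.ofReal ((t - τ) ^ (-(1 / 2 : ℝ))) := by
          gcongr
      _ = ENNReal.ofReal B := by
          -- `∫_{s₀}^t (t - τ)^{-1/2} dτ = 2 √(t - s₀)` (reflect onto `(0, t - s₀)`; the tree's
          -- `setLIntegral_Ioo_sub_rpow_neg_half_of_lt`, `NSBoundedMildOseenDuhamel.lean`)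
          have hmp : MeasurePreserving (fun τ : ℝ => t - τ) volume volume :=
            Measure.measurePreserving_sub_left volume t
          have href := hmp.setLIntegral_comp_preimage_emb
            (MeasurableEquiv.subLeft t).measurableEmbedding
            (fun σ => ENNReal.ofReal (σ ^ (-(1 / 2 : ℝ)))) (Ioo 0 (t - s₀))
          rw [preimage_const_sub_Ioo, sub_zero, sub_sub_cancel] at href
          rw [href, setLIntegral_Ioo_rpow_neg_half (sub_pos.2 (hs.trans_le hst)),
            ← ENNReal.ofReal_mul (by positivity)]
  have hint : Integrable F μ :=
    ⟨hFm.aestronglyMeasurable, hasFiniteIntegral_iff_enorm.2 (hlin.trans_lt ENNReal.ofReal_lt_top)⟩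
  refine ⟨hint, ?_⟩
  rw [integral_norm_eq_lintegral_enorm hint.1]
  exact ENNReal.toReal_le_of_le_ofReal hB0 hlin

/-- **The iterated Duhamel integral equals the product integral** (Fubini under the bound of
`exists_integrable_oseenKernel_restart_slab`): for `s₀ < s₁ ≤ t`,
`∫_{τ ∈ (s₀,s₁)} ∫ K(ν(t-τ), z - y)[w, w] dy dτ = ∫_{(s₀,s₁) × E} K(ν(t-τ), z - y)[w, w] d(τ, y)`. [folklore] -/
theorem setIntegral_integral_oseenKernel_slab_eq_integral_prod (hν : 0 < ν) (hw : Measurable (uncurry w))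
    (hM : ∀ τ y, ‖w τ y‖ ≤ M) {s₀ s₁ t : ℝ} (hs : s₀ < s₁) (hst : s₁ ≤ t) (z : E) :
    ∫ τ in Ioo s₀ s₁, ∫ y, oseenKernel (ν * (t - τ)) (z - y) (w τ y) (w τ y) =
      ∫ p, oseenKernel (ν * (t - p.1)) (z - p.2) (w p.1 p.2) (w p.1 p.2)
        ∂(((volume : Measure ℝ).restrict (Ioo s₀ s₁)).prod (volume : Measure E)) := by
  obtain ⟨B, -, h⟩ := exists_integrable_oseenKernel_restart_slab hν hw hM hs hst
  exact (integral_prod _ (h z).1).symm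

/-- **The slice integrals of the Duhamel term are integrable in time**: for `s₀ < s₁ ≤ t`,
`τ ↦ ∫ K(ν(t-τ), z - y)[w(τ,y), w(τ,y)] dy` is integrable on `(s₀, s₁)` (it is
`O((t-τ)^{-1/2})`; KNSS 2009, §4 p. 8). [cite: KochNadirashviliSereginSverak2009, §4 p. 8 (arXiv:0709.3599)] -/
theorem integrableOn_integral_oseenKernel_slab (hν : 0 < ν) (hw : Measurable (uncurry w))
    (hM : ∀ τ y, ‖w τ y‖ ≤ M) {s₀ s₁ t : ℝ} (hs : s₀ < s₁) (hst : s₁ ≤ t) (z : E) :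
    IntegrableOn (fun τ => ∫ y, oseenKernel (ν * (t - τ)) (z - y) (w τ y) (w τ y)) (Ioo s₀ s₁) := by
  obtain ⟨B, -, h⟩ := exists_integrable_oseenKernel_restart_slab hν hw hM hs hst
  exact (h z).1.integral_prod_left

/-- **A uniform bound for the Duhamel pieces**: for `s₀ < s₁ ≤ t` there is `B` with
`‖∫_{τ ∈ (s₀,s₁)} ∫ K(ν(t-τ), z - y)[w, w] dy dτ‖ ≤ B` for all `z` (KNSS 2009, §4 p. 8,
`‖B(u,v)‖ ≤ C√T‖u‖‖v‖`). [cite: KochNadirashviliSereginSverak2009, §4 p. 8 (arXiv:0709.3599)] -/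
theorem exists_norm_setIntegral_integral_oseenKernel_slab_le (hν : 0 < ν) (hw : Measurable (uncurry w))
    (hM : ∀ τ y, ‖w τ y‖ ≤ M) {s₀ s₁ t : ℝ} (hs : s₀ < s₁) (hst : s₁ ≤ t) :
    ∃ B : ℝ, 0 ≤ B ∧ ∀ z : E,
      ‖∫ τ in Ioo s₀ s₁, ∫ y, oseenKernel (ν * (t - τ)) (z - y) (w τ y) (w τ y)‖ ≤ B := by
  obtain ⟨B, hB, h⟩ := exists_integrable_oseenKernel_restart_slab hν hw hM hs hst
  refine ⟨B, hB, fun z => ?_⟩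
  rw [setIntegral_integral_oseenKernel_slab_eq_integral_prod hν hw hM hs hst z]
  exact (norm_integral_le_integral_norm _).trans (h z).2

/-- **The Duhamel pieces are measurable in the base point**: for `s₀ < s₁ ≤ t`,
`z ↦ ∫_{τ ∈ (s₀,s₁)} ∫ K(ν(t-τ), z - y)[w, w] dy dτ` is strongly measurable (Fubini measurability
of the product integral of the measurable kernel). [folklore] -/
theorem stronglyMeasurable_setIntegral_integral_oseenKernel_slab (hν : 0 < ν)
    (hw : Measurable (uncurry w)) (hM : ∀ τ y, ‖w τ y‖ ≤ M) {s₀ s₁ t : ℝ} (hs : s₀ < s₁)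
    (hst : s₁ ≤ t) :
    StronglyMeasurable fun z : E =>
      ∫ τ in Ioo s₀ s₁, ∫ y, oseenKernel (ν * (t - τ)) (z - y) (w τ y) (w τ y) := by
  have hF : Measurable (fun q : E × (ℝ × E) =>
      oseenKernel (ν * (t - q.2.1)) (q.1 - q.2.2) (w q.2.1 q.2.2) (w q.2.1 q.2.2)) := by
    refine Measurable.oseenKernel_comp
      (measurable_const.mul (measurable_const.sub measurable_snd.fst))
      (measurable_fst.sub measurable_snd.snd) (hw.comp measurable_snd) (hw.comp measurable_snd)
  have h := StronglyMeasurable.integral_prod_right'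
    (ν := ((volume : Measure ℝ).restrict (Ioo s₀ s₁)).prod (volume : Measure E))
    hF.stronglyMeasurable
  have heq : (fun z : E => ∫ τ in Ioo s₀ s₁, ∫ y, oseenKernel (ν * (t - τ)) (z - y) (w τ y) (w τ y)) =
      fun z : E => ∫ p, oseenKernel (ν * (t - p.1)) (z - p.2) (w p.1 p.2) (w p.1 p.2)
        ∂(((volume : Measure ℝ).restrict (Ioo s₀ s₁)).prod (volume : Measure E)) :=
    funext fun z => setIntegral_integral_oseenKernel_slab_eq_integral_prod hν hw hM hs hst z
  rw [heq]
  exact h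

/-- **Splitting the Duhamel term at an intermediate time**: for `s₀ < s < t`,
`B^ν_{s₀}(w,w)(t)(x) = ∫_{τ ∈ (s₀,s)} ∫ K(ν(t-τ), x-y)[w, w] dy dτ + B^ν_s(w,w)(t)(x)` (additivity
of the absolutely convergent time integral; KNSS 2009, §4 p. 8). [cite: KochNadirashviliSereginSverak2009, §4 p. 8 (arXiv:0709.3599)] -/
theorem oseenDuhamel_eq_setIntegral_add_oseenDuhamel (hν : 0 < ν) (hw : Measurable (uncurry w))
    (hM : ∀ τ y, ‖w τ y‖ ≤ M) {s₀ s t : ℝ} (hs₀ : s₀ < s) (hst : s < t) (x : E) :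
    oseenDuhamel ν s₀ w w t x =
      (∫ τ in Ioo s₀ s, ∫ y, oseenKernel (ν * (t - τ)) (x - y) (w τ y) (w τ y)) +
        oseenDuhamel ν s w w t x := by
  rw [oseenDuhamel_apply, oseenDuhamel_apply]
  have hint : IntegrableOn (fun τ => ∫ y, oseenKernel (ν * (t - τ)) (x - y) (w τ y) (w τ y))
      (Ioo s₀ t) := integrableOn_integral_oseenKernel_slab hν hw hM (hs₀.trans hst) le_rfl x
  have hdisj : Disjoint (Ioo s₀ s) (Ico s t) :=
    (Set.Iio_disjoint_Ici le_rfl).mono Ioo_subset_Iio_self Ico_subset_Ici_self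
  rw [← Ioo_union_Ico_eq_Ioo hs₀ hst.le, setIntegral_union hdisj measurableSet_Ico
    (hint.mono_set (Ioo_subset_Ioo le_rfl hst.le)) (hint.mono_set (Ico_subset_Ioo_left hs₀)),
    setIntegral_congr_set (Ioo_ae_eq_Ico (μ := (volume : Measure ℝ)) (a := s) (b := t)).symm]

/-- **The heat flow of a Duhamel piece shifts its kernel times** (the semigroup law
`e^{aΔ}K(b) = K(a+b)` of `OseenKernelSemigroup.lean` under the integral sign, Fubini under the
bound of `exists_integrable_oseenKernel_restart_slab`): for `s₀ < s < t`,
`e^{ν(t-s)Δ}[B^ν_{s₀}(w,w)(s)](x) = ∫_{τ ∈ (s₀,s)} ∫ K(ν(t-τ), x-y)[w(τ,y), w(τ,y)] dy dτ`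
(KNSS 2009, §4 p. 8, `u = U + B(u,u)` "as an ODE in `t`"; Lemarié-Rieusset 2016, (9.38)). [cite: KochNadirashviliSereginSverak2009, §4 p. 8 (arXiv:0709.3599)] -/
theorem heatExtension_oseenDuhamel_eq_setIntegral (hν : 0 < ν) (hw : Measurable (uncurry w))
    (hM : ∀ τ y, ‖w τ y‖ ≤ M) {s₀ s t : ℝ} (hs₀ : s₀ < s) (hst : s < t) (x : E) :
    heatExtension (oseenDuhamel ν s₀ w w s) (ν * (t - s)) x =
      ∫ τ in Ioo s₀ s, ∫ y, oseenKernel (ν * (t - τ)) (x - y) (w τ y) (w τ y) := by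
  set μ : Measure (ℝ × E) := ((volume : Measure ℝ).restrict (Ioo s₀ s)).prod volume with hμ
  have hts : 0 < ν * (t - s) := mul_pos hν (sub_pos.2 hst)
  -- the Duhamel term at time `s` as a product integral, at every base point
  have hD : ∀ z, oseenDuhamel ν s₀ w w s z =
      ∫ p, oseenKernel (ν * (s - p.1)) (z - p.2) (w p.1 p.2) (w p.1 p.2) ∂μ := fun z => by
    rw [oseenDuhamel_apply]
    exact setIntegral_integral_oseenKernel_slab_eq_integral_prod hν hw hM hs₀ le_rfl z
  obtain ⟨B, hB0, hB⟩ := exists_integrable_oseenKernel_restart_slab hν hw hM hs₀ (le_refl s)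
  -- the triple integrand and its integrability on `E × ((s₀, s) × E)`
  set H : E → ℝ × E → E := fun y' p => heatKernel (ν * (t - s)) y' •
    oseenKernel (ν * (s - p.1)) (x - y' - p.2) (w p.1 p.2) (w p.1 p.2) with hH
  have hHm : Measurable (uncurry H) := by
    refine ((UnboundedOperators.continuous_heatKernel _).measurable.comp measurable_fst).smul ?_
    exact Measurable.oseenKernel_comp
      (measurable_const.mul (measurable_const.sub measurable_snd.fst))
      ((measurable_const.sub measurable_fst).sub measurable_snd.snd) (hw.comp measurable_snd)
      (hw.comp measurable_snd)
  have hHint : Integrable (uncurry H) ((volume : Measure E).prod μ) := by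
    refine (integrable_prod_iff hHm.aestronglyMeasurable).2 ⟨?_, ?_⟩
    · exact Eventually.of_forall fun y' => ((hB (x - y')).1).smul (heatKernel (ν * (t - s)) y')
    · have hG := UnboundedOperators.integrable_heatKernel_holds (E := E) hts
      refine (hG.mul_const B).mono' hHm.aestronglyMeasurable.norm.integral_prod_right'
        (Eventually.of_forall fun y' => ?_)
      have hGpos := (UnboundedOperators.heatKernel_pos hts y').le
      rw [Real.norm_of_nonneg (integral_nonneg fun p => norm_nonneg _)]
      calc ∫ p, ‖uncurry H (y', p)‖ ∂μ
          = ∫ p, heatKernel (ν * (t - s)) y' *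
              ‖oseenKernel (ν * (s - p.1)) (x - y' - p.2) (w p.1 p.2) (w p.1 p.2)‖ ∂μ := by
            refine integral_congr_ae (Eventually.of_forall fun p => ?_)
            simp only [uncurry, hH, norm_smul, Real.norm_of_nonneg hGpos]
        _ = heatKernel (ν * (t - s)) y' *
              ∫ p, ‖oseenKernel (ν * (s - p.1)) (x - y' - p.2) (w p.1 p.2) (w p.1 p.2)‖ ∂μ :=
            integral_const_mul _ _
        _ ≤ heatKernel (ν * (t - s)) y' * B := mul_le_mul_of_nonneg_left (hB (x - y')).2 hGpos
  -- a.e. in `p` the kernel time `ν(s - τ)` is positive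
  have hpos : ∀ᵐ p ∂μ, p.1 ∈ Ioo s₀ s :=
    (Measure.quasiMeasurePreserving_fst (μ := (volume : Measure ℝ).restrict (Ioo s₀ s))
      (ν := (volume : Measure E))).ae (ae_restrict_mem measurableSet_Ioo)
  calc heatExtension (oseenDuhamel ν s₀ w w s) (ν * (t - s)) x
      = ∫ y', heatKernel (ν * (t - s)) y' • oseenDuhamel ν s₀ w w s (x - y') :=
        UnboundedOperators.heatExtension_apply _ _ _
    _ = ∫ y', ∫ p, H y' p ∂μ := by
        refine integral_congr_ae (Eventually.of_forall fun y' => ?_)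
        simp only [hH, hD (x - y'), ← integral_smul]
    _ = ∫ p, (∫ y', H y' p) ∂μ := integral_integral_swap hHint
    _ = ∫ p, oseenKernel (ν * (t - p.1)) (x - p.2) (w p.1 p.2) (w p.1 p.2) ∂μ := by
        refine integral_congr_ae ?_
        filter_upwards [hpos] with p hp
        have hσ : 0 < ν * (s - p.1) := mul_pos hν (sub_pos.2 hp.2)
        have h2 : ∀ y', H y' p = heatKernel (ν * (t - s)) y' •
            oseenKernel (ν * (s - p.1)) (x - p.2 - y') (w p.1 p.2) (w p.1 p.2) := fun y' => by
          simp only [hH, sub_right_comm x y' p.2]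
        rw [integral_congr_ae (Eventually.of_forall h2),
          integral_heatKernel_smul_oseenKernel_sub hσ hts (w p.1 p.2) (w p.1 p.2) (x - p.2)]
        congr 1
        ring
    _ = ∫ τ in Ioo s₀ s, ∫ y, oseenKernel (ν * (t - τ)) (x - y) (w τ y) (w τ y) :=
        (setIntegral_integral_oseenKernel_slab_eq_integral_prod hν hw hM hs₀ hst.le x).symm

end Slab

/-! ## The free term: heat extensions of Gaussian-integrable data -/

section Datum

variable {F : Type*} [NormedAddCommGroup F] [NormedSpace ℝ F]

/-- **The caloric extension of measurable data is measurable** (Fubini measurability of the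
convolution integral `x ↦ ∫ G_a(y) f(x - y) dy`). [folklore] -/
theorem aestronglyMeasurable_heatExtension_of_aestronglyMeasurable {f : E → F}
    (hf : AEStronglyMeasurable f volume)
    (a : ℝ) : AEStronglyMeasurable (heatExtension f a) volume :=
  ((UnboundedOperators.continuous_heatKernel a).aestronglyMeasurable.convolution_integrand
    (ContinuousLinearMap.lsmul ℝ ℝ) hf).integral_prod_right'

/-- **The convolution integrand of `e^{aΔ}(e^{sΔ}f)(x)` is integrable** for `f` measurable and
integrable against Gaussians (`a, s > 0`): `‖e^{sΔ}f(z)‖ ≤ (G_s ⋆ ‖f‖)(z)` and the Tonelli bound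
`integrable_heatKernel_mul_convolution_norm`. [folklore] -/
theorem integrable_heatKernel_smul_heatExtension_sub {f : E → F} (hf : AEStronglyMeasurable f volume)
    (hG : ∀ a : ℝ, 0 < a → Integrable (fun y => heatKernel a y * ‖f y‖) volume)
    {s a : ℝ} (hs : 0 < s) (ha : 0 < a) (x : E) :
    Integrable (fun y => heatKernel a y • heatExtension f s (x - y)) volume := by
  have hdom := UnboundedOperators.integrable_heatKernel_mul_convolution_norm hf hG hs ha x
  refine hdom.mono' ((UnboundedOperators.continuous_heatKernel a).aestronglyMeasurable.smul
    ((aestronglyMeasurable_heatExtension_of_aestronglyMeasurable hf s).comp_quasiMeasurePreserving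
      (quasiMeasurePreserving_sub_left volume x))) (Eventually.of_forall fun y => ?_)
  rw [norm_smul]
  refine mul_le_mul_of_nonneg_left ?_ (norm_nonneg _)
  rw [UnboundedOperators.heatExtension_apply, convolution_def]
  refine (norm_integral_le_integral_norm _).trans (le_of_eq ?_)
  refine integral_congr_ae (Eventually.of_forall fun w => ?_)
  simp only [ContinuousLinearMap.mul_apply', norm_smul]

end Datum

/-! ## The restart fact -/

section Restart

variable (E) in
/-- **Discharge of `oseenMild_restart` (KNSS 2009, §4 p. 8: the integral equation
`u = U + B(u,u)` "as an ODE in `t`"; Rem. 4.1; Lemarié-Rieusset 2016, proof of Thm. 9.12,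
(9.38)).** Let `ν > 0` and let `u` be jointly measurable on `(0, T) × E` with measurable
initial slice and slices uniformly essentially bounded on every `[0, T₁)`, `T₁ < T` (datum
included), and `u(t) = e^{νtΔ}u(0) - B^ν_0(u,u)(t)` a.e. for every `t ∈ (0, T)`. Then for all
`0 < s < t < T`, `u(t) = e^{ν(t-s)Δ}u(s) - B^ν_s(u,u)(t)` a.e. Proof: pass to a bounded jointly
measurable representative `w` of `u` on `(0, T₁) × E` (the Duhamel terms and the hypothesis only
see a.e. slices); then `e^{ν(t-s)Δ}u(s) = e^{νtΔ}u(0) - e^{ν(t-s)Δ}B^ν_0(w,w)(s)` (a.e.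
invariance and additivity of the convolution; heat semigroup on Gaussian-integrable data, which
bounded measurable data are),
`e^{ν(t-s)Δ}B^ν_0(w,w)(s) = ∫₀ˢ∫ K(ν(t-τ))[w,w]` (`heatExtension_oseenDuhamel_eq_setIntegral`) and
`B^ν_0(w,w)(t) = ∫₀ˢ∫ K(ν(t-τ))[w,w] + B^ν_s(w,w)(t)` (`oseenDuhamel_eq_setIntegral_add_oseenDuhamel`). [cite: KochNadirashviliSereginSverak2009, §4 p. 8 (u = U + B(u,u) as an ODE in t) and Rem. 4.1 (arXiv:0709.3599)] -/
theorem oseenMild_restart_holds : oseenMild_restart E := by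
  intro ν T hν hT u hmeas hmeas₀ hbd hint s t hs hst htT
  haveI : CompleteSpace E := FiniteDimensional.complete ℝ E
  -- Step 0: a slab `(0, T₁) ∋ s, t` with a uniform essential bound `M` (datum included)
  set T₁ : ℝ := (t + T) / 2 with hT₁
  have htT₁ : t < T₁ := by rw [hT₁]; linarith
  have hT₁T : T₁ < T := by rw [hT₁]; linarith
  have hT₁0 : 0 < T₁ := (hs.trans hst).trans htT₁
  obtain ⟨C, hC, hCb⟩ := hbd T₁ ⟨hT₁0, hT₁T⟩
  set M : ℝ := C.toReal + 1 with hM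
  have hM0 : 0 < M := by positivity
  have hCM : C ≤ ENNReal.ofReal M := by
    rw [← ENNReal.ofReal_toReal hC.ne]
    exact ENNReal.ofReal_le_ofReal (by linarith)
  have hess : ∀ τ ∈ Ico 0 T₁, ∀ᵐ y ∂(volume : Measure E), ‖u τ y‖ ≤ M := by
    intro τ hτ
    have hae : ∀ᵐ y ∂(volume : Measure E), ‖u τ y‖ₑ ≤ ENNReal.ofReal M :=
      (ae_le_eLpNormEssSup (f := u τ)).mono fun y hy =>
        hy.trans (by rw [← eLpNorm_exponent_top]; exact (hCb τ hτ).trans hCM)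
    filter_upwards [hae] with y hy
    rw [← ofReal_norm] at hy
    exact (ENNReal.ofReal_le_ofReal_iff hM0.le).1 hy
  -- the bounded measurable datum is integrable against Gaussians
  have hdat : ∀ a : ℝ, 0 < a → Integrable (fun y => heatKernel a y * ‖u 0 y‖) volume := by
    intro a ha
    refine ((UnboundedOperators.integrable_heatKernel_holds ha).mul_const M).mono'
      ((UnboundedOperators.continuous_heatKernel a).aestronglyMeasurable.mul hmeas₀.norm)
      ((hess 0 ⟨le_rfl, hT₁0⟩).mono fun y hy => ?_)
    rw [norm_mul, Real.norm_of_nonneg (UnboundedOperators.heatKernel_pos ha y).le, norm_norm]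
    exact mul_le_mul_of_nonneg_left hy (UnboundedOperators.heatKernel_pos ha y).le
  -- Step 1: a bounded, jointly measurable representative `w` of `u` on the slab
  set ρ : E → E := fun v => (M / max M ‖v‖) • v with hρ
  have hρc : Continuous ρ := continuous_radialRetract hM0
  have hρM : ∀ v, ‖ρ v‖ ≤ M := norm_radialRetract_le hM0
  have hρid : ∀ v : E, ‖v‖ ≤ M → ρ v = v := fun v hv => radialRetract_eq_self hM0 hv
  have hu₁ : ∀ τ ∈ Ioo 0 T₁, (fun y => ρ (u τ y)) =ᵐ[volume] u τ := by
    intro τ hτ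
    filter_upwards [hess τ ⟨hτ.1.le, hτ.2⟩] with y hy
    exact hρid _ hy
  have hmeas₁ : AEStronglyMeasurable (fun p : ℝ × E => ρ (uncurry u p))
      ((volume : Measure (ℝ × E)).restrict (Ioo 0 T ×ˢ univ)) := hρc.comp_aestronglyMeasurable hmeas
  set U : ℝ × E → E := hmeas₁.mk _ with hU
  have hUm : StronglyMeasurable U := hmeas₁.stronglyMeasurable_mk
  have hUae : (fun p : ℝ × E => ρ (uncurry u p)) =ᵐ[(volume : Measure (ℝ × E)).restrict
      (Ioo 0 T ×ˢ univ)] U := hmeas₁.ae_eq_mk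
  set w : ℝ → E → E := fun τ y => ρ (U (τ, y)) with hw
  have hwm : Measurable (uncurry w) := hρc.measurable.comp hUm.measurable
  have hwM : ∀ τ y, ‖w τ y‖ ≤ M := fun τ y => hρM _
  -- for a.e. `τ ∈ (0, T)` with `τ < T₁`: `u τ = w τ` a.e.
  have hslab : ∀ᵐ p ∂(((volume : Measure ℝ).restrict (Ioo 0 T)).prod (volume : Measure E)),
      ρ (uncurry u p) = uncurry w p := by
    rw [← volume_restrict_prod_univ_eq_prod]
    filter_upwards [hUae] with p hp
    simp only [hw, uncurry]
    rw [← hp]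
    exact (hρid _ (hρM _)).symm
  have hae_slice : ∀ᵐ τ ∂((volume : Measure ℝ).restrict (Ioo 0 T)),
      (fun y => ρ (u τ y)) =ᵐ[volume] w τ :=
    Measure.ae_ae_of_ae_prod hslab
  have hae_u : ∀ᵐ τ ∂((volume : Measure ℝ).restrict (Ioo 0 T)), τ < T₁ → u τ =ᵐ[volume] w τ := by
    filter_upwards [hae_slice, ae_restrict_mem measurableSet_Ioo] with τ hτ hτmem hτT₁
    exact (hu₁ τ ⟨hτmem.1, hτT₁⟩).symm.trans hτ
  -- Step 2: the Duhamel terms of `u` and `w` agree on `(s₀, t') ⊆ [0, T₁]`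
  have hDuh : ∀ {s₀ t' : ℝ}, 0 ≤ s₀ → t' ≤ T₁ → ∀ x,
      oseenDuhamel ν s₀ u u t' x = oseenDuhamel ν s₀ w w t' x := by
    intro s₀ t' hs₀ ht' x
    rw [oseenDuhamel_apply, oseenDuhamel_apply]
    refine integral_congr_ae ?_
    have hsub : Ioo s₀ t' ⊆ Ioo 0 T := Ioo_subset_Ioo hs₀ (ht'.trans hT₁T.le)
    have h1 : ∀ᵐ τ ∂((volume : Measure ℝ).restrict (Ioo s₀ t')), τ < T₁ → u τ =ᵐ[volume] w τ :=
      ae_restrict_of_ae_restrict_of_subset hsub hae_u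
    filter_upwards [h1, ae_restrict_mem measurableSet_Ioo] with τ hτ hτmem
    have hτ' := hτ (hτmem.2.trans_le ht')
    refine integral_congr_ae ?_
    filter_upwards [hτ'] with y hy
    rw [hy]
  -- Step 3: the integral identity with the Duhamel term of `w`
  have hint_w : ∀ t' ∈ Ioo 0 T₁, u t' =ᵐ[volume] fun x =>
      heatExtension (u 0) (ν * t') x - oseenDuhamel ν 0 w w t' x := by
    intro t' ht'
    refine (hint t' ⟨ht'.1, ht'.2.trans hT₁T⟩).trans (Eventually.of_forall fun x => ?_)
    simp only [hDuh le_rfl ht'.2.le x]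
  -- Step 4: the ingredients at a point `x`
  have hts : 0 < ν * (t - s) := mul_pos hν (sub_pos.2 hst)
  have hsg : ∀ x, heatExtension (heatExtension (u 0) (ν * s)) (ν * (t - s)) x =
      heatExtension (u 0) (ν * t) x := by
    intro x
    rw [UnboundedOperators.heatExtension_heatExtension_of_integrable_heatKernel_mul_norm hmeas₀ hdat
      (mul_pos hν hs) hts]
    congr 1
    ring
  have hb1 : ∀ x, heatExtension (oseenDuhamel ν 0 w w s) (ν * (t - s)) x =
      ∫ τ in Ioo 0 s, ∫ y, oseenKernel (ν * (t - τ)) (x - y) (w τ y) (w τ y) :=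
    fun x => heatExtension_oseenDuhamel_eq_setIntegral hν hwm hwM hs hst x
  have hb2 : ∀ x, oseenDuhamel ν 0 w w t x =
      (∫ τ in Ioo 0 s, ∫ y, oseenKernel (ν * (t - τ)) (x - y) (w τ y) (w τ y)) +
        oseenDuhamel ν s w w t x :=
    fun x => oseenDuhamel_eq_setIntegral_add_oseenDuhamel hν hwm hwM hs hst x
  obtain ⟨B, hB0, hB⟩ := exists_norm_setIntegral_integral_oseenKernel_slab_le hν hwm hwM hs (le_refl s)
  have hDm : AEStronglyMeasurable (oseenDuhamel ν 0 w w s) volume := by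
    have h := (stronglyMeasurable_setIntegral_integral_oseenKernel_slab hν hwm hwM hs
      (le_refl s)).aestronglyMeasurable (μ := (volume : Measure E))
    refine h.congr (Eventually.of_forall fun z => ?_)
    exact (oseenDuhamel_apply ν 0 w w s z).symm
  have hI1 : ∀ x, Integrable
      (fun y => heatKernel (ν * (t - s)) y • heatExtension (u 0) (ν * s) (x - y)) volume :=
    fun x => integrable_heatKernel_smul_heatExtension_sub hmeas₀ hdat (mul_pos hν hs) hts x
  have hI2 : ∀ x, Integrable
      (fun y => heatKernel (ν * (t - s)) y • oseenDuhamel ν 0 w w s (x - y)) volume := by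
    intro x
    refine ((UnboundedOperators.integrable_heatKernel_holds hts).mul_const B).mono'
      ((UnboundedOperators.continuous_heatKernel _).aestronglyMeasurable.smul
        (hDm.comp_quasiMeasurePreserving (quasiMeasurePreserving_sub_left volume x)))
      (Eventually.of_forall fun y => ?_)
    rw [norm_smul, Real.norm_of_nonneg (UnboundedOperators.heatKernel_pos hts y).le]
    refine mul_le_mul_of_nonneg_left ?_ (UnboundedOperators.heatKernel_pos hts y).le
    rw [oseenDuhamel_apply]
    exact hB (x - y)
  -- Step 5: the pointwise identity between the two right-hand sides
  have hkey : ∀ x, heatExtension (u s) (ν * (t - s)) x - oseenDuhamel ν s w w t x =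
      heatExtension (u 0) (ν * t) x - oseenDuhamel ν 0 w w t x := by
    intro x
    have h1 : heatExtension (u s) (ν * (t - s)) = heatExtension
        (fun z => heatExtension (u 0) (ν * s) z - oseenDuhamel ν 0 w w s z) (ν * (t - s)) :=
      UnboundedOperators.heatExtension_congr_ae' (hint_w s ⟨hs, hst.trans htT₁⟩) _
    rw [h1, UnboundedOperators.heatExtension_sub_apply_of_integrable (hI1 x) (hI2 x), hsg x,
      hb1 x, hb2 x]
    abel
  -- conclusion
  refine (hint_w t ⟨hs.trans hst, htT₁⟩).trans (Eventually.of_forall fun x => ?_)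
  show heatExtension (u 0) (ν * t) x - oseenDuhamel ν 0 w w t x =
    heatExtension (u s) (ν * (t - s)) x - oseenDuhamel ν s u u t x
  rw [← hkey x, hDuh hs.le htT₁.le x]

end Restart

end Literature.Analysis.FluidPDE
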